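import Mathlib
import HarnessLib.Audit
import Summits.PneNP.PneNP.Theorems.PstarQuadBias

/-!
# Degree-two functions on an `𝔽₂`-cube vanishing on flats, OR-sets and graphs (ROUND-24, GAPTWO-PLAN v1 S4b (b1)–(b4))

FRONTIER range-avoidance ladder, rung F-N3, ROUND 24 (cell `pnp-ideate`, planner memo `r24/CORE-BOUND-NOTES.md` §4 "Z-forcing
classification", sub-lemma list S4b of `r24/GAPTWO-PLAN.md` v1 §6.3; restricted-model proof complexity — nothing here bears on `P` versus `NP`).

In the single-read regime of the core analysis (memo §4) a chord is forced ON along the zero set `Z(q)` of ONE quadratic `q` on the cube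
of AND variables, and everything depends on which degree-`≤ 2` functions `f` vanish on `Z` for the various Dickson types of `q`.  This file
proves the elementary cases, coordinate-free, over any `𝔽₂`-module `M` (functions `M → 𝔽₂`):

* language: `deriv f v x = f (x + v) + f x`; `IsAffineFn m` (`m (x + w) = m x + m w + m 0`); `IsQuadFn f` (`f (x + w) = f x + f w + f 0 + B x w`
  for a bilinear `B` — e.g. `qform T + L + c`, `isQuadFn_of_qform`); the derivative of a quadratic function is affine (`isAffineFn_deriv`),
  of an affine one constant (`deriv_eq_of_affine`);
* MASTER IDENTITY `eq_mul_deriv`: if `λ` flips and `φ` is invariant along `v`, a function vanishing on `{λ = φ}` is `f = (λ + φ) · ∂_v f` — so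
  (b2) HYPERPLANE `{λ = 0}`: `f = λ · ∂_v f` (`eq_mul_deriv_of_hyperplane`; affine `m` vanishing on a hyperplane is `κ·λ`, `affine_eq_mul`);
  (b4) GRAPH `{λ₃ = λ₁λ₂ + c}`: `f = (λ₃ + λ₁λ₂ + c) · ∂_{v₃} f` (`eq_mul_deriv_of_graph`) — the memo's three shapes are `λ·a₁, λ·a₂, λ·(a₁+a₂)`;
* (b1) CODIMENSION-TWO FLAT `{λ₁ = λ₂ = 0}` (dual vectors `v₁, v₂`): `f = λ₁·(∂₁f + κ λ₂) + λ₂·∂₂f` with `κ = ∂₂f(v₁) + ∂₂f(0)`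
  (`eq_of_codimTwo`), both multipliers affine;
* (b3) OR-SET `{λ₁ λ₂ = 0}`: `f = κ · λ₁ λ₂` for a constant `κ` (`eq_const_mul_of_orSet`).

The rank-`≥ 4` rigidity (b5) is NOT of this elementary kind (the elliptic `xy + zw + 1` has `(x+y)(z+w)` in its degree-2 ideal, memo §4) and
is left to the regime theorem; (b6) (rank-2 edge sums are complete tripartite) waits for the form S4d consumes.
-/

set_option linter.dupNamespace false -- `Summit.PneNP.PneNP.…`: summit = sub-problem name (D-0017 single-conjunct layout)

open Summit.PneNP.PneNP.Theorems.PstarProductRank (qform polar)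
open Summit.PneNP.PneNP.Theorems.PstarQuadBias (quadratic_of_qform)

namespace Summit.PneNP.PneNP.Theorems.PstarCubeIdeals

/-- Every element of `𝔽₂` is `0` or `1`. -/
private theorem zmod2_cases (t : ZMod 2) : t = 0 ∨ t = 1 := by
  revert t; decide

/-- In `𝔽₂`, `t ≠ 0 ↔ t = 1`. -/
private theorem zmod2_eq_one_of_ne_zero {t : ZMod 2} (h : t ≠ 0) : t = 1 := by
  revert t h; decide

/-- In `𝔽₂`, `x + x = 0`. -/
private theorem zmod2_add_self (x : ZMod 2) : x + x = 0 := by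
  revert x; decide

variable {M : Type*} [AddCommGroup M] [Module (ZMod 2) M]

/-! ## Derivatives, affine and quadratic functions -/

/-- The discrete derivative `∂_v f (x) = f (x + v) + f x`. -/
def deriv (f : M → ZMod 2) (v : M) : M → ZMod 2 := fun x => f (x + v) + f x

/-- `m` is AFFINE: `m (x + w) = m x + m w + m 0` (characteristic two). -/
def IsAffineFn (m : M → ZMod 2) : Prop := ∀ x w, m (x + w) = m x + m w + m 0

/-- `f` is QUADRATIC (degree `≤ 2`): `f (x + w) = f x + f w + f 0 + B x w` for some bilinear `B` (its polar form). -/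
def IsQuadFn (f : M → ZMod 2) : Prop := ∃ B : LinearMap.BilinForm (ZMod 2) M, ∀ x w, f (x + w) = f x + f w + f 0 + B x w

omit [Module (ZMod 2) M] in
/-- Unfolding `deriv`. -/
theorem deriv_apply (f : M → ZMod 2) (v x : M) : deriv f v x = f (x + v) + f x := rfl

omit [Module (ZMod 2) M] in
/-- Constants are affine. -/
theorem isAffineFn_const (c : ZMod 2) : IsAffineFn (fun _ : M => c) := by
  intro x w; show c = c + c + c; rw [zmod2_add_self, zero_add]

omit [Module (ZMod 2) M] in
/-- Sums of affine functions are affine. -/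
theorem IsAffineFn.add {m m' : M → ZMod 2} (hm : IsAffineFn m) (hm' : IsAffineFn m') : IsAffineFn (fun x => m x + m' x) := by
  intro x w; show m (x + w) + m' (x + w) = _; rw [hm, hm']; ring

omit [Module (ZMod 2) M] in
/-- Constant multiples of affine functions are affine. -/
theorem IsAffineFn.const_mul {m : M → ZMod 2} (hm : IsAffineFn m) (κ : ZMod 2) : IsAffineFn (fun x => κ * m x) := by
  intro x w; show κ * m (x + w) = _; rw [hm]; ring

/-- Affine functions are quadratic (polar form `0`). -/
theorem IsAffineFn.isQuadFn {m : M → ZMod 2} (hm : IsAffineFn m) : IsQuadFn m :=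
  ⟨0, fun x w => by rw [hm]; simp⟩

/-- `qform T + L + c` is quadratic, with polar form `polar T`. -/
theorem isQuadFn_of_qform {ι κ : Type*} (J : Finset κ) (p q : κ → ι) (L : (ι → ZMod 2) →ₗ[ZMod 2] ZMod 2) (c : ZMod 2)
    (f : (ι → ZMod 2) → ZMod 2) (hf : ∀ x, f x = qform J p q x + L x + c) : IsQuadFn f := by
  refine ⟨polar J p q, fun x w => ?_⟩
  rw [hf, hf x, hf w, hf 0, quadratic_of_qform J p q L c x w]
  have h0 : -(qform J p q (0 : ι → ZMod 2) + L 0 + c) = qform J p q 0 + L 0 + c := ZMod.neg_eq_self_mod_two _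
  rw [sub_eq_add_neg, h0]

/-- A linear functional plus a constant is affine. -/
theorem isAffineFn_of_linear (L : M →ₗ[ZMod 2] ZMod 2) (c : ZMod 2) : IsAffineFn (fun x => L x + c) := by
  intro x w; simp only [map_add, map_zero, zero_add]; have := zmod2_add_self c; linear_combination -this

omit [Module (ZMod 2) M] in
/-- **The derivative of an affine function is the constant `m v + m 0`.** -/
theorem deriv_eq_of_affine {m : M → ZMod 2} (hm : IsAffineFn m) (v x : M) : deriv m v x = m v + m 0 := by
  rw [deriv_apply, hm]; have := zmod2_add_self (m x); linear_combination this

/-- **The derivative of a quadratic function is affine.** -/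
theorem isAffineFn_deriv {f : M → ZMod 2} (hf : IsQuadFn f) (v : M) : IsAffineFn (deriv f v) := by
  obtain ⟨B, hB⟩ := hf
  -- the polar form is symmetric (characteristic two)
  have hsym : ∀ a b, B a b = B b a := fun a b => by
    have h1 := hB a b
    have h2 := hB b a
    rw [add_comm b a] at h2
    linear_combination -h1 + h2
  intro x w
  simp only [deriv_apply]
  have e1 : f (x + w + v) = f (x + v) + f w + f 0 + (B (x + v)) w := by
    rw [show x + w + v = (x + v) + w from by abel]; exact hB (x + v) w
  have e2 := hB x w
  have e3 := hB w v
  have e4 : f (0 + v) = f v := by rw [zero_add]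
  have e5 : (B (x + v)) w = (B x) w + (B v) w := by rw [map_add, LinearMap.add_apply]
  have e6 := hsym v w
  have d1 := zmod2_add_self (f w)
  have d2 := zmod2_add_self (f 0)
  have d3 := zmod2_add_self ((B x) w)
  have d4 := zmod2_add_self (f v)
  linear_combination e1 + e2 - e3 - e4 + e5 + e6 + d3 - d4

omit [Module (ZMod 2) M] in
/-- Along a direction that flips `λ`, an affine `λ` satisfies `λ (x + v) = λ x + 1` as soon as it does so at one point. -/
theorem flips_of_affine {lam : M → ZMod 2} (hl : IsAffineFn lam) {v : M} (hv : lam v ≠ lam 0) : ∀ x, lam (x + v) = lam x + 1 := by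
  intro x
  rw [hl]
  have h1 : lam v + lam 0 = 1 := by
    rcases zmod2_cases (lam v) with h | h <;> rcases zmod2_cases (lam 0) with h' | h' <;> rw [h, h'] at hv ⊢ <;>
      first | exact absurd rfl hv | decide
  rw [add_assoc, h1]

omit [Module (ZMod 2) M] in
/-- Along a direction that fixes `φ` at one point, an affine `φ` is invariant. -/
theorem invariant_of_affine {φ : M → ZMod 2} (hφ : IsAffineFn φ) {v : M} (hv : φ v = φ 0) : ∀ x, φ (x + v) = φ x := by
  intro x
  rw [hφ, hv, add_assoc, zmod2_add_self, add_zero]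

/-! ## The master identity -/

omit [Module (ZMod 2) M] in
/-- **Master identity.**  If `λ` flips along `v`, `φ` is invariant along `v`, and `f` vanishes on `{λ = φ}`, then `f = (λ + φ) · ∂_v f`. -/
theorem eq_mul_deriv {f lam φ : M → ZMod 2} {v : M} (hl : ∀ x, lam (x + v) = lam x + 1) (hφ : ∀ x, φ (x + v) = φ x)
    (hZ : ∀ x, lam x = φ x → f x = 0) (x : M) : f x = (lam x + φ x) * deriv f v x := by
  rw [deriv_apply]
  by_cases h : lam x = φ x
  · rw [hZ x h, h, zmod2_add_self, zero_mul]
  · -- `x + v` lies on the set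
    have h1 : lam x + φ x = 1 := by
      rcases zmod2_cases (lam x) with e | e <;> rcases zmod2_cases (φ x) with e' | e' <;> rw [e, e'] at h ⊢ <;>
        first | exact absurd rfl h | decide
    have h2 : lam (x + v) = φ (x + v) := by
      rw [hl, hφ]; linear_combination h1 - zmod2_add_self (φ x) + zmod2_add_self (1 : ZMod 2)
    rw [hZ _ h2, zero_add, h1, one_mul]

/-! ## (b2) Hyperplanes -/

omit [Module (ZMod 2) M] in
/-- **(b2) A function vanishing on the hyperplane `{λ = 0}` is `λ · ∂_v f`** (`v` any direction flipping `λ`). -/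
theorem eq_mul_deriv_of_hyperplane {f lam : M → ZMod 2} {v : M} (hl : ∀ x, lam (x + v) = lam x + 1)
    (hZ : ∀ x, lam x = 0 → f x = 0) (x : M) : f x = lam x * deriv f v x := by
  have h := eq_mul_deriv (f := f) (φ := fun _ => 0) hl (fun _ => rfl) hZ x
  simpa using h

/-- (b2) with the multiplier named: a QUADRATIC `f` vanishing on `{λ = 0}` is `λ · m` with `m = ∂_v f` AFFINE. -/
theorem exists_affine_mul_of_hyperplane {f lam : M → ZMod 2} (hf : IsQuadFn f) {v : M} (hl : ∀ x, lam (x + v) = lam x + 1)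
    (hZ : ∀ x, lam x = 0 → f x = 0) : ∃ m : M → ZMod 2, IsAffineFn m ∧ ∀ x, f x = lam x * m x :=
  ⟨deriv f v, isAffineFn_deriv hf v, eq_mul_deriv_of_hyperplane hl hZ⟩

omit [Module (ZMod 2) M] in
/-- **An AFFINE function vanishing on the hyperplane `{λ = 0}` is the constant multiple `(m v + m 0) · λ`.** -/
theorem affine_eq_mul {m lam : M → ZMod 2} (hm : IsAffineFn m) {v : M} (hl : ∀ x, lam (x + v) = lam x + 1)
    (hZ : ∀ x, lam x = 0 → m x = 0) (x : M) : m x = (m v + m 0) * lam x := by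
  rw [eq_mul_deriv_of_hyperplane hl hZ x, deriv_eq_of_affine hm, mul_comm]

/-! ## (b4) Graphs `{λ₃ = λ₁ λ₂ + c}` -/

omit [Module (ZMod 2) M] in
/-- **(b4) A function vanishing on the graph `{λ₃ = λ₁λ₂ + c}` is `(λ₃ + λ₁λ₂ + c) · ∂_{v₃} f`**, for any direction `v₃` flipping `λ₃`
and fixing `λ₁, λ₂`.  (For quadratic `f` the multiplier `∂_{v₃} f` is affine: `isAffineFn_deriv`.) -/
theorem eq_mul_deriv_of_graph {f l₁ l₂ l₃ : M → ZMod 2} {c : ZMod 2} {v₃ : M} (h₃ : ∀ x, l₃ (x + v₃) = l₃ x + 1)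
    (h₁ : ∀ x, l₁ (x + v₃) = l₁ x) (h₂ : ∀ x, l₂ (x + v₃) = l₂ x) (hZ : ∀ x, l₃ x = l₁ x * l₂ x + c → f x = 0) (x : M) :
    f x = (l₃ x + (l₁ x * l₂ x + c)) * deriv f v₃ x :=
  eq_mul_deriv (φ := fun x => l₁ x * l₂ x + c) h₃ (fun x => by show l₁ (x + v₃) * l₂ (x + v₃) + c = _; rw [h₁, h₂]) hZ x

/-! ## (b1) Codimension-two flats and (b3) OR-sets -/

section TwoLiterals

variable {f l₁ l₂ : M → ZMod 2} {v₁ v₂ : M}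
  (h₁₁ : ∀ x, l₁ (x + v₁) = l₁ x + 1) (h₂₁ : ∀ x, l₂ (x + v₁) = l₂ x)
  (h₁₂ : ∀ x, l₁ (x + v₂) = l₁ x) (h₂₂ : ∀ x, l₂ (x + v₂) = l₂ x + 1)

include h₁₁ h₂₁ h₁₂ h₂₂

omit [Module (ZMod 2) M] in
/-- **(b1) A quadratic function vanishing on the flat `{λ₁ = λ₂ = 0}`** (dual directions `v₁, v₂`) is
`f = λ₁ · (∂₁f + κ·λ₂) + λ₂ · ∂₂f` with `κ = ∂₂f(v₁) + ∂₂f(0)` — both multipliers affine (`isAffineFn_deriv`). -/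
theorem eq_of_codimTwo (hD₂ : IsAffineFn (deriv f v₂)) (hZ : ∀ x, l₁ x = 0 → l₂ x = 0 → f x = 0) (x : M) :
    f x = l₁ x * (deriv f v₁ x + (deriv f v₂ v₁ + deriv f v₂ 0) * l₂ x) + l₂ x * deriv f v₂ x := by
  -- the derivative of the affine `∂₂ f` along `v₁` is the constant `κ`
  have hκ : deriv f v₂ (x + v₁) = deriv f v₂ x + (deriv f v₂ v₁ + deriv f v₂ 0) := by
    have := deriv_eq_of_affine hD₂ v₁ x
    rw [deriv_apply] at this
    have h2 := zmod2_add_self (deriv f v₂ x)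
    linear_combination this - h2
  simp only [deriv_apply] at hκ ⊢
  rcases zmod2_cases (l₁ x) with e₁ | e₁ <;> rcases zmod2_cases (l₂ x) with e₂ | e₂
  · -- on the flat
    rw [hZ x e₁ e₂, e₁, e₂]; ring
  · -- `λ₁ = 0, λ₂ = 1`: `x + v₂` is on the flat
    have hx : f (x + v₂) = 0 := hZ _ (by rw [h₁₂, e₁]) (by rw [h₂₂, e₂]; decide)
    rw [e₁, e₂, hx]; ring
  · -- `λ₁ = 1, λ₂ = 0`: `x + v₁` is on the flat
    have hx : f (x + v₁) = 0 := hZ _ (by rw [h₁₁, e₁]; decide) (by rw [h₂₁, e₂])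
    rw [e₁, e₂, hx]; ring
  · -- `λ₁ = λ₂ = 1`: `x + v₁ + v₂` is on the flat
    have hx : f (x + v₁ + v₂) = 0 :=
      hZ _ (by rw [h₁₂, h₁₁, e₁]; decide) (by rw [h₂₂, h₂₁, e₂]; decide)
    rw [e₁, e₂]
    rw [hx] at hκ
    -- a finite identity in `𝔽₂`
    generalize f x = A at hκ ⊢
    generalize f (x + v₁) = B₁ at hκ ⊢
    generalize f (x + v₂) = B₂ at hκ ⊢
    generalize f (v₁ + v₂) + f v₁ + (f (0 + v₂) + f 0) = K at hκ ⊢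
    revert A B₁ B₂ K
    decide

/-- (b1), existential form: `f = λ₁ m₁ + λ₂ m₂` with `m₁, m₂` affine. -/
theorem exists_affine_of_codimTwo (hf : IsQuadFn f) (hZ : ∀ x, l₁ x = 0 → l₂ x = 0 → f x = 0) (hl₂ : IsAffineFn l₂) :
    ∃ m₁ m₂ : M → ZMod 2, IsAffineFn m₁ ∧ IsAffineFn m₂ ∧ ∀ x, f x = l₁ x * m₁ x + l₂ x * m₂ x :=
  ⟨fun x => deriv f v₁ x + (deriv f v₂ v₁ + deriv f v₂ 0) * l₂ x, deriv f v₂,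
    (isAffineFn_deriv hf v₁).add (hl₂.const_mul _), isAffineFn_deriv hf v₂,
    eq_of_codimTwo h₁₁ h₂₁ h₁₂ h₂₂ (isAffineFn_deriv hf v₂) hZ⟩

omit [Module (ZMod 2) M] h₁₂ in
/-- **(b3) A quadratic function vanishing on the OR-set `{λ₁ λ₂ = 0}` is a constant multiple of `λ₁ λ₂`.** -/
theorem eq_const_mul_of_orSet (hD₁ : IsAffineFn (deriv f v₁)) (hZ : ∀ x, l₁ x = 0 ∨ l₂ x = 0 → f x = 0) (x : M) :
    f x = (deriv f v₁ v₂ + deriv f v₁ 0) * (l₁ x * l₂ x) := by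
  -- `f = λ₁ · ∂₁ f` (hyperplane `λ₁ = 0`)
  have hf₁ : ∀ x, f x = l₁ x * deriv f v₁ x := eq_mul_deriv_of_hyperplane h₁₁ fun x hx => hZ x (Or.inl hx)
  -- `∂₁ f` vanishes on the hyperplane `λ₂ = 0`
  have hD0 : ∀ x, l₂ x = 0 → deriv f v₁ x = 0 := by
    intro x hx
    rw [deriv_apply, hZ x (Or.inr hx), hZ (x + v₁) (Or.inr (by rw [h₂₁, hx])), add_zero]
  rw [hf₁ x, affine_eq_mul hD₁ h₂₂ hD0 x]
  ring

omit h₁₂ in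
/-- (b3), existential form. -/
theorem exists_const_of_orSet (hf : IsQuadFn f) (hZ : ∀ x, l₁ x = 0 ∨ l₂ x = 0 → f x = 0) :
    ∃ κ : ZMod 2, ∀ x, f x = κ * (l₁ x * l₂ x) :=
  ⟨_, eq_const_mul_of_orSet h₁₁ h₂₁ h₂₂ (isAffineFn_deriv hf v₁) hZ⟩

end TwoLiterals

/-! ## Dual directions exist for independent literals -/

omit [Module (ZMod 2) M] in
/-- Two affine functions are INDEPENDENT when all four value patterns of `(λ₁ + λ₁ 0, λ₂ + λ₂ 0)` occur — equivalently their linear parts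
are linearly independent; here recorded through the existence of dual directions. -/
theorem exists_dual_of_affine {l₁ l₂ : M → ZMod 2} (hl₁ : IsAffineFn l₁) (hl₂ : IsAffineFn l₂)
    {a b : M} (ha : l₁ a ≠ l₁ 0 ∧ l₂ a = l₂ 0) (hb : l₁ b = l₁ 0 ∧ l₂ b ≠ l₂ 0) :
    (∀ x, l₁ (x + a) = l₁ x + 1) ∧ (∀ x, l₂ (x + a) = l₂ x) ∧ (∀ x, l₁ (x + b) = l₁ x) ∧ (∀ x, l₂ (x + b) = l₂ x + 1) :=
  ⟨flips_of_affine hl₁ ha.1, invariant_of_affine hl₂ ha.2, invariant_of_affine hl₁ hb.1, flips_of_affine hl₂ hb.2⟩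

end Summit.PneNP.PneNP.Theorems.PstarCubeIdeals
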